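import Literature.MathematicalPhysics.QuantumLattice.HyperoctahedralFockAction
import Literature.MathematicalPhysics.QuantumLattice.PairCorrelationsD4Proofs
import Literature.MathematicalPhysics.QuantumLattice.PairCorrelationsDWaveSymmetryProofs
import HarnessLib

/-!
# `fockRelabel`: the Fock-space unitary of an orbital permutation; torus translations and the
# point group `D₄` as unitary operators on fermionic Fock space

Topic `Literature/MathematicalPhysics/QuantumLattice`; definition request `defn-fockRelabel`
(route HubbardSuperconductivity/RvbParentAnchor, item stmt-HubbardSuperconductivity-2655, whose
`AnchorExists` uses an `s`-channel order guard "standing in for `D₄`/translation symmetry of `P`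
until a second-quantised relabelling unitary is defined"). Vocabulary: `HubbardWave0` (`Fock ι =
Finset ι → ℂ`, `annihilation`, `creation`, `vacuum`, `expect`, `IsNParticle`, `Orb Λ`, `orb`),
`HubbardModel` (`FermionTorus`, `hubbardTorus`, `szSector`, `IsGroundStateInSector`),
`PairCorrelations` (`localPair`, `pairField`, `sWave`, `extendedSWave`, `dWaveFormFactor`,
`d4Site`, `d4Orb`, `b1gChar`).

## What was already in the tree, and what this file adds

The functoriality of the (finite-dimensional, Jordan–Wigner) CAR algebra in the one-particle
space is in the tree: `FermionRelabelling.relabel e` is the Bogoliubov AUTOMORPHISM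
`a ↦ Γ(e) a Γ(e)ᴴ` of an orbital bijection `e : ι ≃ ι'` (`relabel_annihilation : Γ c_i Γᴴ = c_{e i}`),
`HyperoctahedralFockAction.relabelMatrix e` is the signed permutation matrix `Γ(e)` itself with
its cocycle `relabelMatrix_trans`, and `permRep : S_Λ →* U(𝓕)` second-quantises SITE
permutations. This file supplies the requested NAME and the state-level / lattice-symmetry API:

* **`fockRelabel : Equiv.Perm ι →* Matrix.unitaryGroup (Finset ι) ℂ`**, `π ↦ U_π` with
  `U_π |s⟩ = ε_π(s) |π(s)⟩` (`fockRelabel_mulVec_single`; `ε_π = relabelSign π`, the sign of the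
  permutation sorting `π` on `s`), `U_π c_i U_πᴴ = c_{π i}`, `U_π c†_i U_πᴴ = c†_{π i}`,
  `U_π |vac⟩ = |vac⟩`, UNIQUENESS of such an operator (`fockRelabel_unique`, cyclicity of the
  vacuum), `relabel π a = U_π a U_πᴴ`, functoriality of `relabel` (`relabel_trans`, `relabel_refl`,
  `relabel_symm_relabel`), invariance of expectations `expect (relabel π A) (U_π ψ) = expect A ψ`
  and of the norm, and `U_π` preserves the `N`-particle sectors (`IsNParticle.fockRelabel_mulVec`);
* for site permutations `g` (`Orb.mapPerm : S_Λ →* S_{Orb Λ}`): `U_g` preserves the joint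
  `(N, S^z)` sectors `szSector N M` and maps sector ground states of any `g`-invariant `H` to
  sector ground states (`IsGroundStateInSector.fockRelabel_mapEquiv_mulVec`);
* **torus translations** `Orb.translate v` (`(x,σ) ↦ (x+v,σ)` on `Orb (FermionTorus d L)`,
  additive: `Orb.translate_add/zero/neg`), the unitaries `fockTranslate v = U_v`
  (`fockTranslate_add : U_{v+w} = U_v U_w`), `U_v c_{xσ} U_vᴴ = c_{x+v,σ}`, translation
  invariance of `hubbardTorus d L t U` / `hubbardTorusWith` (from the tree's
  `relabel_addRight_hubbardTorusWith`), `U_v P_x U_vᴴ = P_{x+v}` for the local pair operators and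
  `U_v Δ_g U_vᴴ = Δ_g` for the pair field of ANY form factor `g`, hence
  `⟨U_v ψ, Δ_g†Δ_g U_v ψ⟩ = ⟨ψ, Δ_g†Δ_g ψ⟩`;
* **the point group `D₄`** (Mathlib `DihedralGroup 4`): `d4SitePerm : D₄ →* S_{(ℤ/Lℤ)²}`
  (bundling the tree's `d4Site` with `d4Site_mul_holds`), `Orb.d4Perm : D₄ →* S_{Orb}` (pointwise
  the tree's `d4Orb`), the unitary representation **`fockD4 : D₄ →* U(𝓕)`**, the proof that `D₄`
  acts by AUTOMORPHISMS OF THE TORUS GRAPH (`torusGraph_adj_d4Site_iff`) and hence the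
  `D₄`-invariance of `hubbardTorus 2 L t U` (`relabel_d4Perm_hubbardTorus`), the linear action
  `d4Vec` of `D₄` on `ℤ²` (`Torus.proj_d4Vec : π_L ∘ γ = γ ∘ π_L`, it permutes `{0, ±e₁, ±e₂}`),
  the covariance `U_γ P^{g∘γ}_x U_γᴴ = P^g_{γx}`, `U_γ Δ_{g∘γ} U_γᴴ = Δ_g`, and for the three
  standard channels: `Δ_s`, `Δ_{s*}` are `D₄` invariant while **`U_γ Δ_d U_γᴴ = χ_{B₁g}(γ) Δ_d`**
  (`relabel_d4Perm_pairField_dWave`), so all three order parameters `Δ_g†Δ_g` are `D₄` invariant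
  (`relabel_d4Perm_pairField_conjTranspose_mul`, `expect_pairField_fockD4_mulVec`); sector and
  ground-state transport for `fockD4`/`fockTranslate`.

With these a route can TYPE "`P_L` is translation and `D₄` invariant" as
`∀ v, relabel (Orb.translate v) (P L) = P L` and `∀ γ, relabel (Orb.d4Perm γ) (P L) = P L`
(equivalently `Commute (fockTranslate v).val (P L)`, `fockRelabel_commute_of_relabel_eq`), and
obtains that `U_v`, `U_γ` act on the sector ground spaces of `hubbardTorus 2 L 1 U + s • P L`
(`map_add`, `map_smul`, `IsGroundStateInSector.fockD4_mulVec`).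

Everything is PROVED; the file introduces no named fact.

## Mathlib / tree search

Mathlib: `Matrix.unitaryGroup` (`UnitaryGroup.inv_val`, `star_mul_self`), `Equiv.Perm`,
`Equiv.finsetCongr`, `DihedralGroup` (`r_mul_r`, …, `inv_r`), `SimpleGraph.circulantGraph`
(the torus graph), `map_sum`/`map_smul` for `AlgEquiv`; no second quantisation of finite CAR
algebras in Mathlib (`lean search 'fockRelabel|Perm.*unitaryGroup.*Finset'` empty). Tree: see above;
`lean search --decl 'fockRelabel|Orb.translate|d4Perm|d4SitePerm|d4Vec|torusGraph_adj_rotSite'`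
found nothing before this file (2026-08-15).

## Implementation note

On the concrete torus orbitals `Orb (FermionTorus d L)` two `DecidableEq` instances coexist (a
computable one and the one carried by the noncomputable lexicographic `LinearOrder`, which is the
instance the Jordan–Wigner operators, `relabel` and `fockRelabel` are built with; cf. the
`convert … using 2` remark at `hubbardThermalTwoPoint_add_right`). To stay clear of it this file
(i) lets the types of `fockTranslate`, `fockD4` be inferred from `fockRelabel` rather than
re-synthesised, and (ii) uses the generic rewriting lemmas `relabel_sum/mul/smul/sub` instead of
`map_sum` & co. at concrete torus types. Users should likewise write `(fockD4 γ).val`,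
`(fockTranslate v).val` (plain matrices) rather than name the unitary group of the torus.

## References

* O. Bratteli, D. W. Robinson, *Operator Algebras and Quantum Statistical Mechanics II*, 2nd ed.
  (Springer 1997), §5.2.2, Thm. 5.2.5 (Fock representation of the CAR algebra; Bogoliubov
  transformations induced by one-particle unitaries — here permutation matrices — are unitarily
  implemented, `Γ(U) a(f) Γ(U)* = a(Uf)`). [BratteliRobinsonII1997]
* J. Dereziński, C. Gérard, *Mathematics of Quantization and Quantum Fields* (CUP, 2013/2022),
  Def. 3.20 (`Γ(p) = ⊕ₙ p^{⊗n}`), Prop. 3.53 (1) (`Γ(p) a*(w) = a*(pw) Γ(p)`), eqs. (3.25)–(3.26)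
  (cyclicity of the vacuum, whence uniqueness). [DerezinskiGerard2022]
* D. J. Scalapino, Phys. Rep. 250 (1995) 329, §2, eqs. (2.2)–(2.4) (pair field `Δ_g`, the
  square-lattice point group `C₄ᵥ ≅ D₄`, `d_{x²-y²}` ∈ `B₁g`). [Scalapino1995]
* G. Benfatto, A. Giuliani, V. Mastropietro, Ann. Henri Poincaré 7 (2006) 809, §2.1–2.2
  (translation / lattice symmetries of the Hubbard torus). [BenfattoGiulianiMastropietro2006]
* S. Friedli, Y. Velenik, *Statistical Mechanics of Lattice Systems* (CUP 2017), §3.1 (torus,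
  translations). [FriedliVelenik2017]
-/

noncomputable section

namespace Literature.MathematicalPhysics.QuantumLattice

open Matrix Finset HubbardWave0 Literature.Probability.LatticeModels

/-! ### The unitary `U_π` of an orbital permutation -/

section General

variable {ι : Type*} [LinearOrder ι] [Fintype ι]

/-- The signed permutation matrix of an orbital permutation is unitary. [folklore] -/
theorem relabelMatrix_mem_unitaryGroup (π : Equiv.Perm ι) :
    relabelMatrix π ∈ Matrix.unitaryGroup (Finset ι) ℂ := by
  rw [Unitary.mem_iff, star_eq_conjTranspose]
  exact ⟨conjTranspose_mul_relabelMatrix π, relabelMatrix_mul_conjTranspose π⟩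

/-- **`fockRelabel π = U_π`, the Fock-space unitary implementing the orbital permutation `π`**
(functoriality of the CAR algebra in the one-particle space, for the one-particle PERMUTATION
unitary `P_π e_i = e_{π i}`): on the occupation-number basis of `Fock ι = (Finset ι → ℂ)`,
`U_π |s⟩ = ε_π(s) |π(s)⟩`, where `ε_π(s) = relabelSign π s = (-1)^{#inversions of π on s}` is the
sign of the permutation sorting the `π`-images of the increasing enumeration of `s` (the
Jordan–Wigner reordering sign). It is characterised by `U_π c_i U_π⁻¹ = c_{π i}`,
`U_π c†_i U_π⁻¹ = c†_{π i}` (`fockRelabel_conj_annihilation`, `fockRelabel_conj_creation`) and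
`U_π |vac⟩ = |vac⟩` (`fockRelabel_mulVec_vacuum`; uniqueness: `fockRelabel_unique`), and
`π ↦ U_π` is a unitary representation of the permutation group (bundled here as a `MonoidHom`
into Mathlib's `Matrix.unitaryGroup`; the cocycle identity is the tree's `relabelMatrix_trans`).
Its conjugation action is the tree's Bogoliubov automorphism `relabel π`
(`relabel_eq_fockRelabel_conj`), and its matrix is the tree's `relabelMatrix π`
(`fockRelabel_val`, definitional).
[cite: BratteliRobinsonII1997, §5.2.2, Thm. 5.2.5 (Fock representation of the CAR algebra; Bogoliubov transformations of one-particle unitaries are unitarily implemented)]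
[cite: DerezinskiGerard2022, Def. 3.20 and Prop. 3.53 (1) (`Γ(p) a*(w) = a*(pw) Γ(p)`)] -/
def fockRelabel : Equiv.Perm ι →* Matrix.unitaryGroup (Finset ι) ℂ where
  toFun π := ⟨relabelMatrix π, relabelMatrix_mem_unitaryGroup π⟩
  map_one' := Subtype.ext (by
    show relabelMatrix (Equiv.refl ι) = 1
    exact relabelMatrix_refl)
  map_mul' π ρ := Subtype.ext (by
    show relabelMatrix (ρ.trans π) = relabelMatrix π * relabelMatrix ρ
    exact relabelMatrix_trans ρ π)

/-- The matrix of `U_π` is the signed permutation matrix `relabelMatrix π` (definitional). [folklore] -/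
@[simp] theorem fockRelabel_val (π : Equiv.Perm ι) :
    (fockRelabel π).val = relabelMatrix π := rfl

/-- The matrix of `U_π⁻¹` is the adjoint `U_πᴴ`. [folklore] -/
theorem fockRelabel_inv_val (π : Equiv.Perm ι) :
    (fockRelabel π)⁻¹.val = (relabelMatrix π)ᴴ := rfl

/-- `U_{π⁻¹} = U_π⁻¹`. [folklore] -/
theorem fockRelabel_symm (π : Equiv.Perm ι) : fockRelabel π.symm = (fockRelabel π)⁻¹ :=
  map_inv fockRelabel π

/-- `U_πᴴ U_π = 1`. [folklore] -/
theorem fockRelabel_conjTranspose_mul_self (π : Equiv.Perm ι) :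
    (relabelMatrix π)ᴴ * relabelMatrix π = (1 : Matrix (Finset ι) (Finset ι) ℂ) :=
  conjTranspose_mul_relabelMatrix π

/-- `U_π U_πᴴ = 1`. [folklore] -/
theorem fockRelabel_mul_conjTranspose (π : Equiv.Perm ι) :
    relabelMatrix π * (relabelMatrix π)ᴴ = (1 : Matrix (Finset ι) (Finset ι) ℂ) :=
  relabelMatrix_mul_conjTranspose π

/-- Matrix entries: `(U_π)_{s', t} = ε_π(t)` if `s' = π(t)` and `0` otherwise. [folklore] -/
theorem fockRelabel_apply (π : Equiv.Perm ι) (s' t : Finset ι) :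
    (fockRelabel π).val s' t = if s' = t.map π.toEmbedding then relabelSign π t else 0 := by
  rw [fockRelabel_val, relabelMatrix, Equiv.finsetCongr_apply]

/-- **`U_π |s⟩ = ε_π(s) |π(s)⟩`**: the action on occupation-number basis vectors.
[cite: BratteliRobinsonII1997, §5.2.2, Thm. 5.2.5] -/
theorem fockRelabel_mulVec_single (π : Equiv.Perm ι) (s : Finset ι) :
    (fockRelabel π).val *ᵥ Pi.single s (1 : ℂ) =
      relabelSign π s • Pi.single (s.map π.toEmbedding) (1 : ℂ) := by
  ext s'
  rw [mulVec_single_one, col_apply, fockRelabel_apply, Pi.smul_apply, Pi.single_apply, smul_eq_mul,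
    mul_ite, mul_one, mul_zero]

/-- The components of `U_π ψ`: `(U_π ψ)(s') = ε_π(π⁻¹ s') ψ(π⁻¹ s')`. [folklore] -/
theorem fockRelabel_mulVec_apply (π : Equiv.Perm ι) (ψ : Fock ι) (s' : Finset ι) :
    ((fockRelabel π).val *ᵥ ψ) s' =
      relabelSign π (π.finsetCongr.symm s') * ψ (π.finsetCongr.symm s') := by
  obtain ⟨s, rfl⟩ := π.finsetCongr.surjective s'
  rw [Equiv.symm_apply_apply, mulVec, dotProduct, Finset.sum_eq_single s]
  · rw [fockRelabel_val, relabelMatrix_apply_finsetCongr, if_pos rfl]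
  · intro t _ hts
    rw [fockRelabel_val, relabelMatrix_apply_finsetCongr, if_neg (Ne.symm hts), zero_mul]
  · intro h; exact (h (Finset.mem_univ _)).elim

/-- **The conjugation action of `U_π` is the Bogoliubov automorphism `relabel π`**:
`relabel π a = U_π a U_πᴴ`. [cite: BratteliRobinsonII1997, §5.2.2, Thm. 5.2.5] -/
theorem relabel_eq_fockRelabel_conj (π : Equiv.Perm ι) (a : Matrix (Finset ι) (Finset ι) ℂ) :
    relabel π a = (fockRelabel π).val * a * (fockRelabel π).valᴴ :=
  relabel_eq_relabelMatrix_mul π a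

/-- **`U_π c_i U_πᴴ = c_{π i}`.** [cite: BratteliRobinsonII1997, §5.2.2, Thm. 5.2.5 and eq. (5.2.13)] -/
theorem fockRelabel_conj_annihilation (π : Equiv.Perm ι) (i : ι) :
    (fockRelabel π).val * annihilation i * (fockRelabel π).valᴴ = annihilation (π i) :=
  relabelMatrix_mul_annihilation_mul_conjTranspose π i

/-- **`U_π c†_i U_πᴴ = c†_{π i}`.** [cite: BratteliRobinsonII1997, §5.2.2, Thm. 5.2.5 and eq. (5.2.13)] -/
theorem fockRelabel_conj_creation (π : Equiv.Perm ι) (i : ι) :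
    (fockRelabel π).val * creation i * (fockRelabel π).valᴴ = creation (π i) :=
  relabelMatrix_mul_creation_mul_conjTranspose π i

/-- From `U a Uᴴ = b` to the intertwining form `U a = b U`. [folklore] -/
theorem fockRelabel_mul_eq_of_conj_eq (π : Equiv.Perm ι) {a b : Matrix (Finset ι) (Finset ι) ℂ}
    (h : (fockRelabel π).val * a * (fockRelabel π).valᴴ = b) :
    (fockRelabel π).val * a = b * (fockRelabel π).val := by
  rw [← h, fockRelabel_val, Matrix.mul_assoc, Matrix.mul_assoc, conjTranspose_mul_relabelMatrix,
    Matrix.mul_one]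

/-- Intertwining form: `U_π c_i = c_{π i} U_π`. [cite: BratteliRobinsonII1997, §5.2.2, Thm. 5.2.5] -/
theorem fockRelabel_mul_annihilation (π : Equiv.Perm ι) (i : ι) :
    (fockRelabel π).val * annihilation i = annihilation (π i) * (fockRelabel π).val :=
  fockRelabel_mul_eq_of_conj_eq π (fockRelabel_conj_annihilation π i)

/-- Intertwining form: `U_π c†_i = c†_{π i} U_π`. [cite: BratteliRobinsonII1997, §5.2.2, Thm. 5.2.5] -/
theorem fockRelabel_mul_creation (π : Equiv.Perm ι) (i : ι) :
    (fockRelabel π).val * creation i = creation (π i) * (fockRelabel π).val :=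
  fockRelabel_mul_eq_of_conj_eq π (fockRelabel_conj_creation π i)

/-- An operator invariant under `relabel π` commutes with `U_π`. [folklore] -/
theorem fockRelabel_commute_of_relabel_eq (π : Equiv.Perm ι) {a : Matrix (Finset ι) (Finset ι) ℂ}
    (h : relabel π a = a) : Commute (fockRelabel π).val a := by
  rw [relabel_eq_fockRelabel_conj] at h
  exact fockRelabel_mul_eq_of_conj_eq π h

/-- **`U_π |vac⟩ = |vac⟩`.** [cite: BratteliRobinsonII1997, §5.2.2, Thm. 5.2.5] -/
theorem fockRelabel_mulVec_vacuum (π : Equiv.Perm ι) :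
    (fockRelabel π).val *ᵥ (vacuum : Fock ι) = vacuum :=
  relabelMatrix_mulVec_vacuum π

/-- `U_πᴴ |vac⟩ = |vac⟩`. [folklore] -/
theorem fockRelabel_conjTranspose_mulVec_vacuum (π : Equiv.Perm ι) :
    (fockRelabel π).valᴴ *ᵥ (vacuum : Fock ι) = vacuum := by
  conv_lhs => rw [← fockRelabel_mulVec_vacuum π]
  rw [mulVec_mulVec, fockRelabel_val, conjTranspose_mul_relabelMatrix, one_mulVec]

/-- `U_πᴴ c†_{π i} = c†_i U_πᴴ`. [folklore] -/
theorem fockRelabel_conjTranspose_mul_creation (π : Equiv.Perm ι) (i : ι) :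
    (fockRelabel π).valᴴ * creation (π i) = creation i * (fockRelabel π).valᴴ := by
  rw [← fockRelabel_conj_creation π i, fockRelabel_val, Matrix.mul_assoc,
    ← Matrix.mul_assoc (relabelMatrix π)ᴴ, conjTranspose_mul_relabelMatrix, Matrix.one_mul]

/-- **Uniqueness (cyclicity of the vacuum).** `U_π` is the only operator that intertwines the
creation operators, `V c†_i = c†_{π i} V`, and fixes the vacuum.
[cite: DerezinskiGerard2022, Prop. 3.53 (1) and eqs. (3.25)–(3.26) (cyclicity of the vacuum)] -/
theorem fockRelabel_unique (π : Equiv.Perm ι) (V : Matrix (Finset ι) (Finset ι) ℂ)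
    (hc : ∀ i, V * creation i = creation (π i) * V) (hv : V *ᵥ (vacuum : Fock ι) = vacuum) :
    V = (fockRelabel π).val := by
  -- `W = U_πᴴ V` commutes with every `c†_i` and fixes the vacuum, hence `W = 1`.
  have hW : (fockRelabel π).valᴴ * V = 1 := by
    refine eq_one_of_commute_creation_of_mulVec_vacuum _ (fun i => ?_) ?_
    · rw [Matrix.mul_assoc, hc i, ← Matrix.mul_assoc, fockRelabel_conjTranspose_mul_creation,
        Matrix.mul_assoc]
    · rw [← mulVec_mulVec, hv, fockRelabel_conjTranspose_mulVec_vacuum]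
  calc V = (fockRelabel π).val * ((fockRelabel π).valᴴ * V) := by
          rw [← Matrix.mul_assoc, fockRelabel_val, relabelMatrix_mul_conjTranspose, Matrix.one_mul]
    _ = (fockRelabel π).val := by rw [hW, Matrix.mul_one]

/-- `relabel` is functorial: `relabel (f.trans e) = relabel e ∘ relabel f`. [folklore] -/
theorem relabel_trans {ι' ι'' : Type*} [LinearOrder ι'] [Fintype ι'] [LinearOrder ι''] [Fintype ι'']
    (f : ι ≃ ι') (e : ι' ≃ ι'') (A : Matrix (Finset ι) (Finset ι) ℂ) :
    relabel (f.trans e) A = relabel e (relabel f A) := by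
  rw [relabel_eq_relabelMatrix_mul, relabel_eq_relabelMatrix_mul, relabel_eq_relabelMatrix_mul,
    relabelMatrix_trans, conjTranspose_mul]
  simp only [Matrix.mul_assoc]

/-- `relabel (Equiv.refl ι) = id`. [folklore] -/
theorem relabel_refl (A : Matrix (Finset ι) (Finset ι) ℂ) : relabel (Equiv.refl ι) A = A := by
  rw [relabel_eq_relabelMatrix_mul, relabelMatrix_refl, conjTranspose_one, Matrix.one_mul,
    Matrix.mul_one]

/-- `relabel e.symm (relabel e A) = A`. [folklore] -/
theorem relabel_symm_relabel {ι' : Type*} [LinearOrder ι'] [Fintype ι'] (e : ι ≃ ι')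
    (A : Matrix (Finset ι) (Finset ι) ℂ) : relabel e.symm (relabel e A) = A := by
  rw [← relabel_trans, Equiv.self_trans_symm, relabel_refl]

/-- `relabel e (relabel e.symm B) = B`. [folklore] -/
theorem relabel_relabel_symm {ι' : Type*} [LinearOrder ι'] [Fintype ι'] (e : ι ≃ ι')
    (B : Matrix (Finset ι') (Finset ι') ℂ) : relabel e (relabel e.symm B) = B := by
  rw [← relabel_trans, Equiv.symm_trans_self, relabel_refl]

/-! Algebra-homomorphism properties of `relabel`, restated as plain rewriting lemmas (generic in the
orbital type, so that they can be used at concrete torus types without `map_sum`'s class search). -/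

section RelabelAlgebra

variable {ι' : Type*} [LinearOrder ι'] [Fintype ι'] (e : ι ≃ ι')

/-- `relabel` is additive over finite sums. [folklore] -/
theorem relabel_sum {κ : Type*} (s : Finset κ) (f : κ → Matrix (Finset ι) (Finset ι) ℂ) :
    relabel e (∑ k ∈ s, f k) = ∑ k ∈ s, relabel e (f k) :=
  map_sum (relabel e) f s

/-- `relabel` is multiplicative. [folklore] -/
theorem relabel_mul (a b : Matrix (Finset ι) (Finset ι) ℂ) : relabel e (a * b) = relabel e a * relabel e b :=
  map_mul (relabel e) a b

/-- `relabel` is `ℂ`-linear (scalars). [folklore] -/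
theorem relabel_smul (c : ℂ) (a : Matrix (Finset ι) (Finset ι) ℂ) : relabel e (c • a) = c • relabel e a :=
  map_smul (relabel e) c a

/-- `relabel` is additive. [folklore] -/
theorem relabel_add (a b : Matrix (Finset ι) (Finset ι) ℂ) : relabel e (a + b) = relabel e a + relabel e b :=
  map_add (relabel e) a b

/-- `relabel` respects subtraction. [folklore] -/
theorem relabel_sub (a b : Matrix (Finset ι) (Finset ι) ℂ) : relabel e (a - b) = relabel e a - relabel e b :=
  map_sub (relabel e) a b

end RelabelAlgebra

/-- **Expectation values are invariant**: `⟨U_π ψ, (U_π A U_πᴴ) U_π ψ⟩ = ⟨ψ, A ψ⟩`, i.e.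
`expect (relabel π A) (U_π ψ) = expect A ψ`. [cite: BratteliRobinsonII1997, §5.2.2, Thm. 5.2.5] -/
theorem expect_relabel_fockRelabel_mulVec (π : Equiv.Perm ι) (A : Matrix (Finset ι) (Finset ι) ℂ)
    (ψ : Fock ι) :
    expect (relabel π A) ((fockRelabel π).val *ᵥ ψ) = expect A ψ := by
  rw [expect, expect, relabel_eq_fockRelabel_conj, fockRelabel_val, mulVec_mulVec, Matrix.mul_assoc,
    Matrix.mul_assoc, conjTranspose_mul_relabelMatrix, Matrix.mul_one, star_mulVec, ← mulVec_mulVec,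
    dotProduct_mulVec, vecMul_vecMul, conjTranspose_mul_relabelMatrix, vecMul_one]

/-- Equivalently `⟨U_π ψ, A U_π ψ⟩ = ⟨ψ, (U_πᴴ A U_π) ψ⟩ = expect (relabel π⁻¹ A) ψ`. [folklore] -/
theorem expect_fockRelabel_mulVec (π : Equiv.Perm ι) (A : Matrix (Finset ι) (Finset ι) ℂ)
    (ψ : Fock ι) :
    expect A ((fockRelabel π).val *ᵥ ψ) = expect (relabel π.symm A) ψ := by
  conv_lhs => rw [← relabel_relabel_symm π A]
  exact expect_relabel_fockRelabel_mulVec π _ ψ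

/-- **`U_π` preserves the norm**: `⟨U_π ψ, U_π ψ⟩ = ⟨ψ, ψ⟩`. [folklore] -/
theorem star_fockRelabel_mulVec_dotProduct (π : Equiv.Perm ι) (ψ : Fock ι) :
    star ((fockRelabel π).val *ᵥ ψ) ⬝ᵥ ((fockRelabel π).val *ᵥ ψ) = star ψ ⬝ᵥ ψ := by
  have h := expect_relabel_fockRelabel_mulVec π 1 ψ
  rwa [map_one, expect, expect, Matrix.one_mulVec, Matrix.one_mulVec] at h

/-- `U_π` is injective on vectors (it is unitary). [folklore] -/
theorem fockRelabel_mulVec_injective (π : Equiv.Perm ι) :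
    Function.Injective fun ψ : Fock ι => (fockRelabel π).val *ᵥ ψ := by
  intro ψ φ h
  have h2 := congrArg (fun w => (relabelMatrix π)ᴴ *ᵥ w) h
  simpa only [fockRelabel_val, mulVec_mulVec, conjTranspose_mul_relabelMatrix, one_mulVec] using h2

/-- **`U_π` preserves the `N`-particle sectors** (it permutes the occupation basis preserving
`|s|`). [cite: BratteliRobinsonII1997, §5.2.2, Thm. 5.2.5] -/
theorem IsNParticle.fockRelabel_mulVec {N : ℕ} {ψ : Fock ι} (hψ : IsNParticle N ψ)
    (π : Equiv.Perm ι) : IsNParticle N ((fockRelabel π).val *ᵥ ψ) := by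
  intro s' hs'
  rw [fockRelabel_mulVec_apply, hψ _ (by rwa [Equiv.finsetCongr_symm, Equiv.finsetCongr_apply,
    Finset.card_map]), mul_zero]

end General


/-! ### Site permutations: sectors and sector ground states -/

section Sites

variable {Λ : Type*}

/-- `Orb.mapEquiv` (`(x, σ) ↦ (g x, σ)`) as a monoid homomorphism `S_Λ →* S_{Orb Λ}`. [folklore] -/
def Orb.mapPerm : Equiv.Perm Λ →* Equiv.Perm (Orb Λ) where
  toFun := Orb.mapEquiv
  map_one' := Orb.mapEquiv_refl
  map_mul' g h := by
    show Orb.mapEquiv (h.trans g) = _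
    rw [Orb.mapEquiv_trans]
    rfl

/-- `Orb.mapPerm g = Orb.mapEquiv g` (definitional). [folklore] -/
@[simp] theorem Orb.mapPerm_apply (g : Equiv.Perm Λ) : Orb.mapPerm g = Orb.mapEquiv g := rfl

variable [LinearOrder Λ] [Fintype Λ]

/-- On site permutations `fockRelabel ∘ Orb.mapEquiv` is the tree's `permRep`
(`HyperoctahedralFockAction`). [folklore] -/
theorem fockRelabel_mapEquiv_eq_permRep (g : Equiv.Perm Λ) :
    fockRelabel (Orb.mapEquiv g) = permRep g := rfl

/-- `U_g n_{xσ} U_gᴴ = n_{g x, σ}` for a site permutation `g`. [folklore] -/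
theorem fockRelabel_mapEquiv_conj_numberOp (g : Equiv.Perm Λ) (x : Λ) (σ : Fin 2) :
    (fockRelabel (Orb.mapEquiv g)).val * numberOp x σ * (fockRelabel (Orb.mapEquiv g)).valᴴ =
      numberOp (g x) σ := by
  rw [← relabel_eq_fockRelabel_conj, relabel_mapEquiv_numberOp]

/-- `U_g` commutes with the total particle number `N`. [folklore] -/
theorem fockRelabel_mapEquiv_commute_totalNumber (g : Equiv.Perm Λ) :
    Commute (fockRelabel (Orb.mapEquiv g)).val (totalNumber : Matrix (Finset (Orb Λ)) _ ℂ) :=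
  fockRelabel_commute_of_relabel_eq _ (relabel_mapEquiv_totalNumber g)

/-- `U_g` commutes with `S^z`. [folklore] -/
theorem fockRelabel_mapEquiv_commute_spinZ (g : Equiv.Perm Λ) :
    Commute (fockRelabel (Orb.mapEquiv g)).val (HubbardWave0.spinZ : Matrix (Finset (Orb Λ)) _ ℂ) :=
  fockRelabel_commute_of_relabel_eq _ (relabel_mapEquiv_spinZ g)

/-- **`U_g` preserves the joint `(N, S^z)` sectors** `szSector N M`. [folklore] -/
theorem fockRelabel_mapEquiv_mulVec_mem_szSector (g : Equiv.Perm Λ) {N : ℕ} {M : ℝ}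
    {ψ : Fock (Orb Λ)} (hψ : ψ ∈ szSector N M) :
    (fockRelabel (Orb.mapEquiv g)).val *ᵥ ψ ∈ szSector N M := by
  rw [mem_szSector_iff] at hψ ⊢
  refine ⟨hψ.1.fockRelabel_mulVec _, ?_⟩
  rw [mulVec_mulVec, ← (fockRelabel_mapEquiv_commute_spinZ g).eq, ← mulVec_mulVec, hψ.2, mulVec_smul]

/-- **Symmetries map sector ground states to sector ground states.** If `H` is invariant under the
site permutation `g` (`relabel (Orb.mapEquiv g) H = H`, i.e. `[U_g, H] = 0`), then `U_g ψ` is a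
ground state of `H` in the sector `(N, S^z = M)` whenever `ψ` is. [folklore] -/
theorem IsGroundStateInSector.fockRelabel_mapEquiv_mulVec (g : Equiv.Perm Λ)
    {H : Matrix (Finset (Orb Λ)) (Finset (Orb Λ)) ℂ} (hH : relabel (Orb.mapEquiv g) H = H)
    {N : ℕ} {M : ℝ} {ψ : Fock (Orb Λ)} (hψ : IsGroundStateInSector H N M ψ) :
    IsGroundStateInSector H N M ((fockRelabel (Orb.mapEquiv g)).val *ᵥ ψ) := by
  obtain ⟨hmem, hne, heig⟩ := hψ
  refine ⟨fockRelabel_mapEquiv_mulVec_mem_szSector g hmem, fun h0 => hne ?_, ?_⟩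
  · exact fockRelabel_mulVec_injective (Orb.mapEquiv g)
      (show _ *ᵥ ψ = _ *ᵥ (0 : Fock (Orb Λ)) by rw [h0, mulVec_zero])
  · rw [mulVec_mulVec, ← (fockRelabel_commute_of_relabel_eq _ hH).eq, ← mulVec_mulVec, heig,
      mulVec_smul]

end Sites

/-! ### Torus translations as operators on Fock space -/

section Translations

variable {d L : ℕ} [NeZero L]

namespace FermionTorus

/-- `ofTorusEquiv g x = ofTorusSite (g (toTorusSite x))` (definitional). [folklore] -/
theorem ofTorusEquiv_apply (g : TorusSite d L ≃ TorusSite d L) (x : FermionTorus d L) :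
    ofTorusEquiv g x = ofTorusSite (g (toTorusSite x)) := rfl

/-- `ofTorusEquiv 1 = 1`. [folklore] -/
theorem ofTorusEquiv_one : ofTorusEquiv (1 : Equiv.Perm (TorusSite d L)) = 1 := by
  ext x : 1
  rw [ofTorusEquiv_apply, Equiv.Perm.one_apply, Equiv.Perm.one_apply, ofTorusSite_toTorusSite]

/-- `ofTorusEquiv (g * h) = ofTorusEquiv g * ofTorusEquiv h`. [folklore] -/
theorem ofTorusEquiv_mul (g h : Equiv.Perm (TorusSite d L)) :
    ofTorusEquiv (g * h) = ofTorusEquiv g * ofTorusEquiv h := by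
  ext x : 1
  rw [ofTorusEquiv_apply, Equiv.Perm.mul_apply, Equiv.Perm.mul_apply, ofTorusEquiv_apply,
    ofTorusEquiv_apply, toTorusSite_ofTorusSite]

/-- The site bijections of the fermionic torus induced by torus bijections, as a monoid
homomorphism `S_{(ℤ/Lℤ)^d} →* S_{FermionTorus d L}` (conjugation by `equivTorusSite`). [folklore] -/
def ofTorusPerm : Equiv.Perm (TorusSite d L) →* Equiv.Perm (FermionTorus d L) where
  toFun := ofTorusEquiv
  map_one' := ofTorusEquiv_one
  map_mul' := ofTorusEquiv_mul

/-- `ofTorusPerm g = ofTorusEquiv g` (definitional). [folklore] -/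
@[simp] theorem ofTorusPerm_apply (g : Equiv.Perm (TorusSite d L)) :
    ofTorusPerm g = ofTorusEquiv g := rfl

end FermionTorus

/-- **The translation `(x, σ) ↦ (x + v, σ)` of the orbitals of the fermionic torus `(ℤ/Lℤ)^d`**
(sites compared through `FermionTorus.equivTorusSite`). [cite: FriedliVelenik2017, §3.1 (translations of the torus)] -/
def Orb.translate (v : TorusSite d L) : Equiv.Perm (Orb (FermionTorus d L)) :=
  Orb.mapEquiv (FermionTorus.ofTorusEquiv (Equiv.addRight v))

/-- `Orb.translate v (x, σ) = (x + v, σ)`. [folklore] -/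
@[simp] theorem Orb.translate_orb (v x : TorusSite d L) (σ : Fin 2) :
    Orb.translate v (orb (FermionTorus.ofTorusSite x) σ) = orb (FermionTorus.ofTorusSite (x + v)) σ := by
  rw [Orb.translate, Orb.mapEquiv_orb, FermionTorus.ofTorusEquiv_ofTorusSite, Equiv.coe_addRight]

/-- `Orb.translate v` on a general orbital. [folklore] -/
theorem Orb.translate_apply (v : TorusSite d L) (o : Orb (FermionTorus d L)) :
    Orb.translate v o =
      orb (FermionTorus.ofTorusSite (FermionTorus.toTorusSite (ofLex o).1 + v)) (ofLex o).2 := rfl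

/-- `Orb.translate 0 = 1`. [folklore] -/
theorem Orb.translate_zero : Orb.translate (0 : TorusSite d L) = 1 := by
  ext o : 1
  rw [Orb.translate_apply, add_zero, FermionTorus.ofTorusSite_toTorusSite]
  rfl

/-- **Translations compose additively**: `T_{v + w} = T_v T_w`. [folklore] -/
theorem Orb.translate_add (v w : TorusSite d L) :
    Orb.translate (v + w) = Orb.translate v * Orb.translate w := by
  ext o : 1
  rw [Equiv.Perm.mul_apply, Orb.translate_apply w o, Orb.translate_orb, Orb.translate_apply,
    add_assoc, add_comm v w]

/-- Translations commute. [folklore] -/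
theorem Orb.translate_comm (v w : TorusSite d L) :
    Orb.translate v * Orb.translate w = Orb.translate w * Orb.translate v := by
  rw [← Orb.translate_add, add_comm, Orb.translate_add]

/-- `T_{-v} = T_v⁻¹`. [folklore] -/
theorem Orb.translate_neg (v : TorusSite d L) : Orb.translate (-v) = (Orb.translate v)⁻¹ := by
  have h : Orb.translate (-v) * Orb.translate v = 1 := by
    rw [← Orb.translate_add, neg_add_cancel, Orb.translate_zero]
  exact eq_inv_of_mul_eq_one_left h

/-- **The translation unitaries `U_v = fockRelabel (Orb.translate v)` on `Fock (Orb (FermionTorus d L))`**: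
`U_v c_{xσ} U_vᴴ = c_{x+v,σ}`. [cite: BratteliRobinsonII1997, §5.2.2, Thm. 5.2.5] -/
abbrev fockTranslate (v : TorusSite d L) := fockRelabel (Orb.translate v)

/-- `U_0 = 1`. [folklore] -/
theorem fockTranslate_zero : fockTranslate (0 : TorusSite d L) = 1 := by
  rw [fockTranslate, Orb.translate_zero, map_one]

/-- **`U_{v+w} = U_v U_w`**: the translations form a unitary representation of `(ℤ/Lℤ)^d`. [folklore] -/
theorem fockTranslate_add (v w : TorusSite d L) :
    fockTranslate (v + w) = fockTranslate v * fockTranslate w := by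
  rw [fockTranslate, Orb.translate_add, map_mul]

/-- `U_{-v} = U_v⁻¹`. [folklore] -/
theorem fockTranslate_neg (v : TorusSite d L) : fockTranslate (-v) = (fockTranslate v)⁻¹ := by
  rw [fockTranslate, Orb.translate_neg, map_inv]

/-- `T_v c_{xσ} T_v⁻¹ = c_{x+v,σ}`. [cite: BratteliRobinsonII1997, §5.2.2, Thm. 5.2.5] -/
theorem relabel_translate_annihilation (v x : TorusSite d L) (σ : Fin 2) :
    relabel (Orb.translate v) (annihilation (orb (FermionTorus.ofTorusSite x) σ)) =
      annihilation (orb (FermionTorus.ofTorusSite (x + v)) σ) := by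
  rw [relabel_annihilation, Orb.translate_orb]

/-- `T_v c†_{xσ} T_v⁻¹ = c†_{x+v,σ}`. [cite: BratteliRobinsonII1997, §5.2.2, Thm. 5.2.5] -/
theorem relabel_translate_creation (v x : TorusSite d L) (σ : Fin 2) :
    relabel (Orb.translate v) (creation (orb (FermionTorus.ofTorusSite x) σ)) =
      creation (orb (FermionTorus.ofTorusSite (x + v)) σ) := by
  rw [relabel_creation, Orb.translate_orb]

/-- `T_v n_{xσ} T_v⁻¹ = n_{x+v,σ}`. [folklore] -/
theorem relabel_translate_numberOp (v x : TorusSite d L) (σ : Fin 2) :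
    relabel (Orb.translate v) (numberOp (FermionTorus.ofTorusSite x) σ) =
      numberOp (FermionTorus.ofTorusSite (x + v)) σ := by
  rw [Orb.translate, relabel_mapEquiv_numberOp, FermionTorus.ofTorusEquiv_ofTorusSite,
    Equiv.coe_addRight]

/-- **Translation invariance of the grand-canonical Hubbard Hamiltonian on the torus**,
`T_v (H - μN) T_v⁻¹ = H - μN` (the tree's `relabel_addRight_hubbardTorusWith`).
[cite: BenfattoGiulianiMastropietro2006, §2.2 (translation invariance)] -/
theorem relabel_translate_hubbardTorusWith (v : TorusSite d L) (t U μ : ℝ) :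
    relabel (Orb.translate v) (hubbardTorusWith d L t U μ) = hubbardTorusWith d L t U μ :=
  relabel_addRight_hubbardTorusWith v t U μ

/-- **Translation invariance of the Hubbard Hamiltonian on the torus**, `T_v H T_v⁻¹ = H`.
[cite: BenfattoGiulianiMastropietro2006, §2.2 (translation invariance)] -/
theorem relabel_translate_hubbardTorus (v : TorusSite d L) (t U : ℝ) :
    relabel (Orb.translate v) (hubbardTorus d L t U) = hubbardTorus d L t U := by
  rw [← hubbardTorusWith_zero, relabel_translate_hubbardTorusWith]

/-- `[U_v, H] = 0` for the Hubbard Hamiltonian on the torus. [folklore] -/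
theorem fockTranslate_commute_hubbardTorus (v : TorusSite d L) (t U : ℝ) :
    Commute (fockTranslate v).val (hubbardTorus d L t U) :=
  fockRelabel_commute_of_relabel_eq _ (relabel_translate_hubbardTorus v t U)

/-- `U_v` preserves the joint `(N, S^z)` sectors. [folklore] -/
theorem fockTranslate_mulVec_mem_szSector (v : TorusSite d L) {N : ℕ} {M : ℝ}
    {ψ : Fock (Orb (FermionTorus d L))} (hψ : ψ ∈ szSector N M) :
    (fockTranslate v).val *ᵥ ψ ∈ szSector N M :=
  fockRelabel_mapEquiv_mulVec_mem_szSector _ hψ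

/-- A translation-invariant `H` has translation-covariant sector ground states: `U_v ψ` is a
sector ground state whenever `ψ` is. [folklore] -/
theorem IsGroundStateInSector.fockTranslate_mulVec (v : TorusSite d L)
    {H : Matrix (Finset (Orb (FermionTorus d L))) (Finset (Orb (FermionTorus d L))) ℂ}
    (hH : relabel (Orb.translate v) H = H) {N : ℕ} {M : ℝ} {ψ : Fock (Orb (FermionTorus d L))}
    (hψ : IsGroundStateInSector H N M ψ) : IsGroundStateInSector H N M ((fockTranslate v).val *ᵥ ψ) :=
  hψ.fockRelabel_mapEquiv_mulVec _ hH

end Translations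

/-! ### Translation covariance of the pair operators on `(ℤ/Lℤ)²` -/

section TranslationsPair

variable {L : ℕ} [NeZero L] (g : Site 2 → ℝ)

/-- **`T_v P_x T_v⁻¹ = P_{x+v}`** for the local pair operator with any form factor `g`.
[cite: Scalapino1995, §2 eq. (2.2)] -/
theorem relabel_translate_localPair (v x : TorusSite 2 L) :
    relabel (Orb.translate v) (localPair g L x) = localPair g L (x + v) := by
  unfold localPair
  rw [relabel_sum]
  refine Finset.sum_congr rfl fun e _ => ?_
  rw [relabel_smul, relabel_sub, relabel_mul, relabel_mul, relabel_translate_annihilation,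
    relabel_translate_annihilation, relabel_translate_annihilation, relabel_translate_annihilation,
    add_right_comm x _ v]

/-- **The pair field is translation invariant**: `T_v Δ_g T_v⁻¹ = Δ_g`. [cite: Scalapino1995, §2 eq. (2.2)] -/
theorem relabel_translate_pairField (v : TorusSite 2 L) :
    relabel (Orb.translate v) (pairField g L) = pairField g L := by
  unfold pairField
  rw [relabel_sum]
  simp_rw [relabel_translate_localPair]
  exact Fintype.sum_equiv (Equiv.addRight v) _ _ fun x => rfl

/-- `T_v (Δ_g† Δ_g) T_v⁻¹ = Δ_g† Δ_g`. [folklore] -/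
theorem relabel_translate_pairField_conjTranspose_mul (v : TorusSite 2 L) :
    relabel (Orb.translate v) ((pairField g L)ᴴ * pairField g L) = (pairField g L)ᴴ * pairField g L := by
  rw [relabel_mul, relabel_conjTranspose, relabel_translate_pairField]

/-- **The pair-field order parameter is translation invariant**:
`⟨U_v ψ, Δ_g† Δ_g U_v ψ⟩ = ⟨ψ, Δ_g† Δ_g ψ⟩`. [folklore] -/
theorem expect_pairField_fockTranslate_mulVec (v : TorusSite 2 L) (ψ : Fock (Orb (FermionTorus 2 L))) :
    expect ((pairField g L)ᴴ * pairField g L) ((fockTranslate v).val *ᵥ ψ) =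
      expect ((pairField g L)ᴴ * pairField g L) ψ := by
  have h := expect_relabel_fockRelabel_mulVec (Orb.translate v) ((pairField g L)ᴴ * pairField g L) ψ
  rwa [relabel_translate_pairField_conjTranspose_mul] at h

end TranslationsPair

/-! ### The point group `D₄` of the square torus as operators on Fock space -/

section PointGroup

open DihedralGroup

variable {L : ℕ}

/-- **The site action of `D₄` as permutations**: `d4Site γ` with inverse `d4Site γ⁻¹`, bundled as
a homomorphism `D₄ →* S_{(ℤ/Lℤ)²}` (from the tree's `d4Site_mul_holds`, `d4Site_one`).
[cite: Scalapino1995, §2 (square-lattice point group `C₄ᵥ ≅ D₄`)] -/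
def d4SitePerm : DihedralGroup 4 →* Equiv.Perm (TorusSite 2 L) where
  toFun γ :=
    { toFun := d4Site γ
      invFun := d4Site γ⁻¹
      left_inv := fun x => by
        rw [← (d4Site_mul_holds γ⁻¹ γ x : d4Site (γ⁻¹ * γ) x = _), inv_mul_cancel, d4Site_one]
      right_inv := fun x => by
        rw [← (d4Site_mul_holds γ γ⁻¹ x : d4Site (γ * γ⁻¹) x = _), mul_inv_cancel, d4Site_one] }
  map_one' := Equiv.ext fun x => d4Site_one x
  map_mul' γ₁ γ₂ := Equiv.ext fun x => d4Site_mul_holds γ₁ γ₂ x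

/-- `d4SitePerm γ x = d4Site γ x` (definitional). [folklore] -/
@[simp] theorem d4SitePerm_apply (γ : DihedralGroup 4) (x : TorusSite 2 L) :
    d4SitePerm γ x = d4Site γ x := rfl

/-- `(d4SitePerm γ)⁻¹ x = d4Site γ⁻¹ x`. [folklore] -/
theorem d4SitePerm_symm_apply (γ : DihedralGroup 4) (x : TorusSite 2 L) :
    (d4SitePerm γ).symm x = d4Site γ⁻¹ x := rfl

/-- `d4Site γ⁻¹ (d4Site γ x) = x`. [folklore] -/
@[simp] theorem d4Site_inv_apply (γ : DihedralGroup 4) (x : TorusSite 2 L) :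
    d4Site γ⁻¹ (d4Site γ x) = x :=
  (d4SitePerm (L := L) γ).left_inv x

/-- `d4Site γ (d4Site γ⁻¹ x) = x`. [folklore] -/
@[simp] theorem d4Site_apply_inv (γ : DihedralGroup 4) (x : TorusSite 2 L) :
    d4Site γ (d4Site γ⁻¹ x) = x :=
  (d4SitePerm (L := L) γ).right_inv x

/-- `d4Site γ` is injective. [folklore] -/
theorem d4Site_injective (γ : DihedralGroup 4) : Function.Injective (d4Site (L := L) γ) :=
  (d4SitePerm (L := L) γ).injective

/-- **`D₄` acts on the torus by additive maps**: `γ (x + y) = γ x + γ y`. [folklore] -/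
theorem d4Site_add (γ : DihedralGroup 4) (x y : TorusSite 2 L) :
    d4Site γ (x + y) = d4Site γ x + d4Site γ y := by
  have hrot : ∀ n : ℕ, ∀ x y : TorusSite 2 L,
      rotSite^[n] (x + y) = rotSite^[n] x + rotSite^[n] y := by
    intro n
    induction n with
    | zero => intro x y; rfl
    | succ n ih =>
      intro x y
      rw [Function.iterate_succ_apply', Function.iterate_succ_apply',
        Function.iterate_succ_apply', ih, rotSite_add]
  cases γ with
  | r i => exact hrot i.val x y
  | sr i =>
    show reflSite (rotSite^[i.val] (x + y)) = reflSite (rotSite^[i.val] x) + reflSite (rotSite^[i.val] y)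
    rw [hrot, reflSite_add]

/-! #### `D₄` acts by automorphisms of the torus graph -/

/-- `rot (x + e₁) = rot x + e₂`. [folklore] -/
theorem rotSite_add_single_zero (x : TorusSite 2 L) :
    rotSite (x + Pi.single 0 1) = rotSite x + Pi.single 1 1 := by
  funext k; fin_cases k <;> simp [rotSite]

/-- `rot (x + e₂) + e₁ = rot x`. [folklore] -/
theorem rotSite_add_single_one (x : TorusSite 2 L) :
    rotSite (x + Pi.single 1 1) + Pi.single 0 1 = rotSite x := by
  funext k; fin_cases k <;> simp [rotSite]

/-- `refl (x + e₁) = refl x + e₁`. [folklore] -/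
theorem reflSite_add_single_zero (x : TorusSite 2 L) :
    reflSite (x + Pi.single 0 1) = reflSite x + Pi.single 0 1 := by
  funext k; fin_cases k <;> simp [reflSite]

/-- `refl (x + e₂) + e₂ = refl x`. [folklore] -/
theorem reflSite_add_single_one (x : TorusSite 2 L) :
    reflSite (x + Pi.single 1 1) + Pi.single 1 1 = reflSite x := by
  funext k; fin_cases k <;> simp [reflSite]

/-- The rotation by `π/2` preserves nearest-neighbour adjacency on the torus `(ℤ/Lℤ)²`.
[cite: Scalapino1995, §2 (square-lattice point group)] -/
theorem torusGraph_adj_rotSite {x y : TorusSite 2 L} (h : (torusGraph 2 L).Adj x y) :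
    (torusGraph 2 L).Adj (rotSite x) (rotSite y) := by
  rw [torusGraph_adj_iff] at h ⊢
  obtain ⟨hne, h⟩ := h
  refine ⟨fun h' => hne (rotSite_injective h'), ?_⟩
  rcases h with ⟨i, rfl⟩ | ⟨i, rfl⟩ <;> fin_cases i
  · exact Or.inl ⟨1, rotSite_add_single_zero x⟩
  · exact Or.inr ⟨0, (rotSite_add_single_one x).symm⟩
  · exact Or.inr ⟨1, rotSite_add_single_zero y⟩
  · exact Or.inl ⟨0, (rotSite_add_single_one y).symm⟩

/-- The axis reflection preserves nearest-neighbour adjacency on the torus `(ℤ/Lℤ)²`.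
[cite: Scalapino1995, §2 (square-lattice point group)] -/
theorem torusGraph_adj_reflSite {x y : TorusSite 2 L} (h : (torusGraph 2 L).Adj x y) :
    (torusGraph 2 L).Adj (reflSite x) (reflSite y) := by
  rw [torusGraph_adj_iff] at h ⊢
  obtain ⟨hne, h⟩ := h
  refine ⟨fun h' => hne (reflSite_injective h'), ?_⟩
  rcases h with ⟨i, rfl⟩ | ⟨i, rfl⟩ <;> fin_cases i
  · exact Or.inl ⟨0, reflSite_add_single_zero x⟩
  · exact Or.inr ⟨1, (reflSite_add_single_one x).symm⟩
  · exact Or.inr ⟨0, reflSite_add_single_zero y⟩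
  · exact Or.inl ⟨1, (reflSite_add_single_one y).symm⟩

/-- Every element of `D₄` preserves nearest-neighbour adjacency on the torus. [cite: Scalapino1995, §2] -/
theorem torusGraph_adj_d4Site (γ : DihedralGroup 4) {x y : TorusSite 2 L}
    (h : (torusGraph 2 L).Adj x y) : (torusGraph 2 L).Adj (d4Site γ x) (d4Site γ y) := by
  have hrot : ∀ n : ℕ, ∀ {x y : TorusSite 2 L}, (torusGraph 2 L).Adj x y →
      (torusGraph 2 L).Adj (rotSite^[n] x) (rotSite^[n] y) := by
    intro n
    induction n with
    | zero => intro x y h; exact h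
    | succ n ih =>
      intro x y h
      rw [Function.iterate_succ_apply', Function.iterate_succ_apply']
      exact torusGraph_adj_rotSite (ih h)
  cases γ with
  | r i => exact hrot i.val h
  | sr i => exact torusGraph_adj_reflSite (hrot i.val h)

/-- **`D₄` acts by graph automorphisms of the nearest-neighbour torus graph.** [cite: Scalapino1995, §2] -/
theorem torusGraph_adj_d4Site_iff (γ : DihedralGroup 4) (x y : TorusSite 2 L) :
    (torusGraph 2 L).Adj (d4Site γ x) (d4Site γ y) ↔ (torusGraph 2 L).Adj x y := by
  refine ⟨fun h => ?_, torusGraph_adj_d4Site γ⟩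
  have h' := torusGraph_adj_d4Site γ⁻¹ h
  rwa [d4Site_inv_apply, d4Site_inv_apply] at h'

variable [NeZero L]

/-- The induced automorphisms of the fermionic torus graph. [cite: Scalapino1995, §2] -/
theorem fermionTorusGraph_adj_d4SitePerm (γ : DihedralGroup 4) (x y : FermionTorus 2 L) :
    (fermionTorusGraph 2 L).Adj (FermionTorus.ofTorusEquiv (d4SitePerm γ) x)
        (FermionTorus.ofTorusEquiv (d4SitePerm γ) y) ↔ (fermionTorusGraph 2 L).Adj x y := by
  rw [fermionTorusGraph_adj, fermionTorusGraph_adj, FermionTorus.toTorusSite_ofTorusEquiv,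
    FermionTorus.toTorusSite_ofTorusEquiv]
  exact torusGraph_adj_d4Site_iff γ _ _

/-- **The action of `D₄` on the orbitals of the fermionic torus as permutations**, a homomorphism
`D₄ →* S_{Orb (FermionTorus 2 L)}`; pointwise it is the tree's `d4Orb` (`Orb.d4Perm_apply`).
[cite: Scalapino1995, §2] -/
def Orb.d4Perm : DihedralGroup 4 →* Equiv.Perm (Orb (FermionTorus 2 L)) :=
  Orb.mapPerm.comp (FermionTorus.ofTorusPerm.comp d4SitePerm)

/-- `Orb.d4Perm γ` is `Orb.mapEquiv` of the site permutation (definitional). [folklore] -/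
theorem Orb.d4Perm_eq_mapEquiv (γ : DihedralGroup 4) :
    Orb.d4Perm (L := L) γ = Orb.mapEquiv (FermionTorus.ofTorusEquiv (d4SitePerm γ)) := rfl

/-- `Orb.d4Perm γ o = d4Orb γ o`: agreement with the tree's (unbundled) orbital action. [folklore] -/
@[simp] theorem Orb.d4Perm_apply (γ : DihedralGroup 4) (o : Orb (FermionTorus 2 L)) :
    Orb.d4Perm γ o = d4Orb γ o := rfl

/-- `Orb.d4Perm γ (x, σ) = (γ x, σ)` on torus coordinates. [folklore] -/
theorem Orb.d4Perm_orb (γ : DihedralGroup 4) (x : TorusSite 2 L) (σ : Fin 2) :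
    Orb.d4Perm γ (orb (FermionTorus.ofTorusSite x) σ) = orb (FermionTorus.ofTorusSite (d4Site γ x)) σ := by
  simp only [Orb.d4Perm_apply, d4Orb, ofLex_toLex, FermionTorus.toTorusSite_ofTorusSite]

/-- **The unitary representation `γ ↦ U_γ = fockRelabel (Orb.d4Perm γ)` of the point group `D₄` on
`Fock (Orb (FermionTorus 2 L))`**: `U_γ c_{xσ} U_γᴴ = c_{γx,σ}`. [cite: BratteliRobinsonII1997, §5.2.2, Thm. 5.2.5] -/
def fockD4 := (fockRelabel (ι := Orb (FermionTorus 2 L))).comp Orb.d4Perm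

/-- `fockD4 γ = fockRelabel (Orb.d4Perm γ)` (definitional). [folklore] -/
@[simp] theorem fockD4_apply (γ : DihedralGroup 4) : fockD4 (L := L) γ = fockRelabel (Orb.d4Perm γ) := rfl

/-- `U_γ c_{xσ} U_γ⁻¹ = c_{γ x, σ}`. [cite: BratteliRobinsonII1997, §5.2.2, Thm. 5.2.5] -/
theorem relabel_d4Perm_annihilation (γ : DihedralGroup 4) (x : TorusSite 2 L) (σ : Fin 2) :
    relabel (Orb.d4Perm γ) (annihilation (orb (FermionTorus.ofTorusSite x) σ)) =
      annihilation (orb (FermionTorus.ofTorusSite (d4Site γ x)) σ) := by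
  rw [relabel_annihilation, Orb.d4Perm_orb]

/-- `U_γ c†_{xσ} U_γ⁻¹ = c†_{γ x, σ}`. [cite: BratteliRobinsonII1997, §5.2.2, Thm. 5.2.5] -/
theorem relabel_d4Perm_creation (γ : DihedralGroup 4) (x : TorusSite 2 L) (σ : Fin 2) :
    relabel (Orb.d4Perm γ) (creation (orb (FermionTorus.ofTorusSite x) σ)) =
      creation (orb (FermionTorus.ofTorusSite (d4Site γ x)) σ) := by
  rw [relabel_creation, Orb.d4Perm_orb]

/-- **`D₄` invariance of the grand-canonical Hubbard Hamiltonian on the square torus**: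
`U_γ (H - μN) U_γ⁻¹ = H - μN`. [cite: Scalapino1995, §2] -/
theorem relabel_d4Perm_hubbardTorusWith (γ : DihedralGroup 4) (t U μ : ℝ) :
    relabel (Orb.d4Perm γ) (hubbardTorusWith 2 L t U μ) = hubbardTorusWith 2 L t U μ :=
  relabel_hamiltonianWith _ _ _ (fermionTorusGraph_adj_d4SitePerm γ) t U μ

/-- **`D₄` invariance of the Hubbard Hamiltonian on the square torus**: `U_γ H U_γ⁻¹ = H`.
[cite: Scalapino1995, §2] -/
theorem relabel_d4Perm_hubbardTorus (γ : DihedralGroup 4) (t U : ℝ) :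
    relabel (Orb.d4Perm γ) (hubbardTorus 2 L t U) = hubbardTorus 2 L t U := by
  rw [← hubbardTorusWith_zero, relabel_d4Perm_hubbardTorusWith]

/-- `[U_γ, H] = 0`. [folklore] -/
theorem fockD4_commute_hubbardTorus (γ : DihedralGroup 4) (t U : ℝ) :
    Commute (fockD4 (L := L) γ).val (hubbardTorus 2 L t U) :=
  fockRelabel_commute_of_relabel_eq _ (relabel_d4Perm_hubbardTorus γ t U)

/-- `U_γ` preserves the joint `(N, S^z)` sectors. [folklore] -/
theorem fockD4_mulVec_mem_szSector (γ : DihedralGroup 4) {N : ℕ} {M : ℝ}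
    {ψ : Fock (Orb (FermionTorus 2 L))} (hψ : ψ ∈ szSector N M) :
    (fockD4 (L := L) γ).val *ᵥ ψ ∈ szSector N M :=
  fockRelabel_mapEquiv_mulVec_mem_szSector _ hψ

/-- A `D₄`-invariant `H` has `D₄`-covariant sector ground states. [folklore] -/
theorem IsGroundStateInSector.fockD4_mulVec (γ : DihedralGroup 4)
    {H : Matrix (Finset (Orb (FermionTorus 2 L))) (Finset (Orb (FermionTorus 2 L))) ℂ}
    (hH : relabel (Orb.d4Perm γ) H = H) {N : ℕ} {M : ℝ} {ψ : Fock (Orb (FermionTorus 2 L))}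
    (hψ : IsGroundStateInSector H N M ψ) : IsGroundStateInSector H N M ((fockD4 (L := L) γ).val *ᵥ ψ) :=
  hψ.fockRelabel_mapEquiv_mulVec _ hH

end PointGroup

/-! ### The linear action of `D₄` on `ℤ²` and the covariance of the pair operators -/

section PointGroupPair

open DihedralGroup

/-- **The linear action of `D₄` on `ℤ²`** (pair separations / form-factor arguments):
`r i ↦ rot^i`, `sr i ↦ refl ∘ rot^i` with `rot (a, b) = (-b, a)`, `refl (a, b) = (a, -b)`, matching
`d4Site` under `Torus.proj` (`Torus.proj_d4Vec`). [cite: Scalapino1995, §2] -/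
def d4Vec : DihedralGroup 4 → Site 2 → Site 2
  | r i, e => (fun v : Site 2 => (![-v 1, v 0] : Site 2))^[i.val] e
  | sr i, e => (fun v : Site 2 => (![v 0, -v 1] : Site 2))
      ((fun v : Site 2 => (![-v 1, v 0] : Site 2))^[i.val] e)

/-- **`Torus.proj` intertwines `d4Vec` with `d4Site`.** [folklore] -/
theorem Torus.proj_d4Vec (L : ℕ) (γ : DihedralGroup 4) (e : Site 2) :
    Torus.proj L (d4Vec γ e) = d4Site γ (Torus.proj L e) := by
  have hrot : ∀ n : ℕ, ∀ e : Site 2,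
      Torus.proj L ((fun v : Site 2 => (![-v 1, v 0] : Site 2))^[n] e) = rotSite^[n] (Torus.proj L e) := by
    intro n
    induction n with
    | zero => intro e; rfl
    | succ n ih =>
      intro e
      rw [Function.iterate_succ_apply', Function.iterate_succ_apply', Torus.proj_rotate, ih]
  cases γ with
  | r i => exact hrot i.val e
  | sr i =>
    show Torus.proj L (![_, _]) = reflSite (rotSite^[i.val] (Torus.proj L e))
    rw [Torus.proj_reflect, hrot]

/-- **`d4Vec γ` permutes the step set `{0, ±e₁, ±e₂}`**: sums over it may be reindexed. [folklore] -/
theorem sum_steps_d4Vec {M : Type*} [AddCommMonoid M] (γ : DihedralGroup 4) (F : Site 2 → M) :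
    ∑ e ∈ insert (0 : Site 2) unitSteps, F (d4Vec γ e) = ∑ e ∈ insert (0 : Site 2) unitSteps, F e := by
  have hrot : ∀ n : ℕ, ∀ F : Site 2 → M,
      ∑ e ∈ insert (0 : Site 2) unitSteps, F ((fun v : Site 2 => (![-v 1, v 0] : Site 2))^[n] e) =
        ∑ e ∈ insert (0 : Site 2) unitSteps, F e := by
    intro n
    induction n with
    | zero => intro F; rfl
    | succ n ih =>
      intro F
      simp only [Function.iterate_succ_apply]
      rw [sum_steps_rotate (fun e => F ((fun v : Site 2 => (![-v 1, v 0] : Site 2))^[n] e)), ih]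
  cases γ with
  | r i => exact hrot i.val F
  | sr i =>
    show ∑ e ∈ insert (0 : Site 2) unitSteps,
        F (![((fun v : Site 2 => (![-v 1, v 0] : Site 2))^[i.val] e) 0,
          -((fun v : Site 2 => (![-v 1, v 0] : Site 2))^[i.val] e) 1]) = _
    rw [hrot i.val (fun e => F ![e 0, -e 1]), sum_steps_reflect]

/-- `d4Vec γ e = 0 ↔ e = 0` (the action is linear and injective). [folklore] -/
theorem d4Vec_eq_zero_iff (γ : DihedralGroup 4) (e : Site 2) : d4Vec γ e = 0 ↔ e = 0 := by
  have hrot1 : ∀ v : Site 2, ((![-v 1, v 0] : Site 2) = 0 ↔ v = 0) := by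
    intro v
    simp only [funext_iff, Fin.forall_fin_two, Matrix.cons_val_zero, Matrix.cons_val_one, Pi.zero_apply,
      neg_eq_zero]
    tauto
  have hrefl1 : ∀ v : Site 2, ((![v 0, -v 1] : Site 2) = 0 ↔ v = 0) := by
    intro v
    simp only [funext_iff, Fin.forall_fin_two, Matrix.cons_val_zero, Matrix.cons_val_one, Pi.zero_apply,
      neg_eq_zero]
  have hrot : ∀ n : ℕ, ∀ e : Site 2,
      ((fun v : Site 2 => (![-v 1, v 0] : Site 2))^[n] e = 0 ↔ e = 0) := by
    intro n
    induction n with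
    | zero => intro e; rfl
    | succ n ih => intro e; rw [Function.iterate_succ_apply', hrot1, ih]
  cases γ with
  | r i => exact hrot i.val e
  | sr i => exact (hrefl1 _).trans (hrot i.val e)

/-- `d4Vec γ` is injective. [folklore] -/
theorem d4Vec_injective (γ : DihedralGroup 4) : Function.Injective (d4Vec γ) := by
  have hrot1 : Function.Injective fun v : Site 2 => (![-v 1, v 0] : Site 2) := by
    intro a b h
    have h0 := congrFun h 0
    have h1 := congrFun h 1
    simp only [Matrix.cons_val_zero, Matrix.cons_val_one, neg_inj] at h0 h1
    funext i; fin_cases i <;> assumption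
  have hrefl1 : Function.Injective fun v : Site 2 => (![v 0, -v 1] : Site 2) := by
    intro a b h
    have h0 := congrFun h 0
    have h1 := congrFun h 1
    simp only [Matrix.cons_val_zero, Matrix.cons_val_one, neg_inj] at h0 h1
    funext i; fin_cases i <;> assumption
  cases γ with
  | r i => exact hrot1.iterate i.val
  | sr i => exact hrefl1.comp (hrot1.iterate i.val)

/-- `d4Vec γ` maps unit steps to unit steps. [folklore] -/
theorem d4Vec_mem_unitSteps (γ : DihedralGroup 4) {e : Site 2} (he : e ∈ unitSteps) :
    d4Vec γ e ∈ unitSteps := by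
  have hrot1 : ∀ v : Site 2, v ∈ unitSteps → (![-v 1, v 0] : Site 2) ∈ unitSteps := by
    intro v hv
    simp only [unitSteps, Finset.mem_insert, Finset.mem_singleton] at hv ⊢
    rcases hv with rfl | rfl | rfl | rfl <;> decide
  have hrefl1 : ∀ v : Site 2, v ∈ unitSteps → (![v 0, -v 1] : Site 2) ∈ unitSteps := by
    intro v hv
    simp only [unitSteps, Finset.mem_insert, Finset.mem_singleton] at hv ⊢
    rcases hv with rfl | rfl | rfl | rfl <;> decide
  have hrot : ∀ n : ℕ, ∀ e : Site 2, e ∈ unitSteps →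
      (fun v : Site 2 => (![-v 1, v 0] : Site 2))^[n] e ∈ unitSteps := by
    intro n
    induction n with
    | zero => intro e he; exact he
    | succ n ih => intro e he; rw [Function.iterate_succ_apply']; exact hrot1 _ (ih e he)
  cases γ with
  | r i => exact hrot i.val e he
  | sr i => exact hrefl1 _ (hrot i.val e he)

/-- **`d4Vec γ` permutes the four unit steps.** [folklore] -/
theorem d4Vec_mem_unitSteps_iff (γ : DihedralGroup 4) (e : Site 2) :
    d4Vec γ e ∈ unitSteps ↔ e ∈ unitSteps := by
  refine ⟨fun h => ?_, d4Vec_mem_unitSteps γ⟩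
  -- the image of `unitSteps` under the injective map `d4Vec γ` is all of `unitSteps`
  have himg : unitSteps.image (d4Vec γ) = unitSteps := by
    apply Finset.eq_of_subset_of_card_le
    · intro v hv
      obtain ⟨w, hw, rfl⟩ := Finset.mem_image.1 hv
      exact d4Vec_mem_unitSteps γ hw
    · rw [Finset.card_image_of_injective _ (d4Vec_injective γ)]
  rw [← himg] at h
  obtain ⟨w, hw, hwe⟩ := Finset.mem_image.1 h
  rwa [← d4Vec_injective γ hwe]

/-- The on-site form factor is `D₄` invariant. [cite: Scalapino1995, §2] -/
theorem sWave_d4Vec (γ : DihedralGroup 4) (e : Site 2) : sWave (d4Vec γ e) = sWave e := by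
  simp only [sWave, d4Vec_eq_zero_iff]

/-- The extended-`s` form factor is `D₄` invariant. [cite: Scalapino1995, §2] -/
theorem extendedSWave_d4Vec (γ : DihedralGroup 4) (e : Site 2) :
    extendedSWave (d4Vec γ e) = extendedSWave e := by
  simp only [extendedSWave, d4Vec_mem_unitSteps_iff]

/-- **The `d_{x²-y²}` form factor transforms by the `B₁g` character**:
`g_d (γ e) = χ_{B₁g}(γ) g_d (e)` with `χ_{B₁g}(r^i) = χ_{B₁g}(s r^i) = (-1)^i` (real form).
[cite: Scalapino1995, §2 eq. (2.3)] -/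
theorem dWaveFormFactor_d4Vec (γ : DihedralGroup 4) (e : Site 2) :
    dWaveFormFactor (d4Vec γ e) =
      (match γ with | r i => (-1 : ℝ) ^ i.val | sr i => (-1 : ℝ) ^ i.val) * dWaveFormFactor e := by
  have hrot : ∀ n : ℕ, ∀ e : Site 2,
      dWaveFormFactor ((fun v : Site 2 => (![-v 1, v 0] : Site 2))^[n] e) = (-1) ^ n * dWaveFormFactor e := by
    intro n
    induction n with
    | zero => intro e; simp
    | succ n ih =>
      intro e
      rw [Function.iterate_succ_apply', dWaveFormFactor_rotate_holds, ih, pow_succ]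
      ring
  cases γ with
  | r i => exact hrot i.val e
  | sr i =>
    show dWaveFormFactor (![_, _]) = (-1 : ℝ) ^ i.val * dWaveFormFactor e
    rw [dWaveFormFactor_reflect, hrot]

/-- The same in `ℂ`, with the tree's character `b1gChar`: `g_d (γ e) = χ_{B₁g}(γ) g_d (e)`.
[cite: Scalapino1995, §2 eq. (2.3)] -/
theorem ofReal_dWaveFormFactor_d4Vec (γ : DihedralGroup 4) (e : Site 2) :
    ((dWaveFormFactor (d4Vec γ e) : ℝ) : ℂ) = b1gChar γ * dWaveFormFactor e := by
  rw [dWaveFormFactor_d4Vec]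
  cases γ <;> (push_cast; rfl)

/-- `χ_{B₁g}(γ)` is a sign: `conj χ · χ = 1`. [folklore] -/
theorem star_b1gChar_mul_self (γ : DihedralGroup 4) : star (b1gChar γ) * b1gChar γ = 1 := by
  cases γ <;> simp [b1gChar, ← pow_add, ← two_mul, pow_mul]

/-- `χ_{B₁g}(γ)² = 1`. [folklore] -/
theorem b1gChar_mul_self (γ : DihedralGroup 4) : b1gChar γ * b1gChar γ = 1 := by
  cases γ <;> simp [b1gChar, ← pow_add, ← two_mul, pow_mul]

variable {L : ℕ} [NeZero L]

/-- The local pair operator is `ℝ`-linear in the form factor (scalars). [folklore] -/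
theorem localPair_const_mul (c : ℝ) (g : Site 2 → ℝ) (x : TorusSite 2 L) :
    localPair (fun e => c * g e) L x = (c : ℂ) • localPair g L x := by
  unfold localPair
  rw [Finset.smul_sum]
  refine Finset.sum_congr rfl fun e _ => ?_
  rw [smul_smul]
  congr 1
  push_cast
  ring

/-- The pair field is `ℝ`-linear in the form factor (scalars). [folklore] -/
theorem pairField_const_mul (c : ℝ) (g : Site 2 → ℝ) :
    pairField (fun e => c * g e) L = (c : ℂ) • pairField g L := by
  unfold pairField
  rw [Finset.smul_sum]
  exact Finset.sum_congr rfl fun x _ => localPair_const_mul c g x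

/-- **`D₄` covariance of the local pair operators**: `U_γ P^{g∘γ}_x U_γ⁻¹ = P^{g}_{γ x}`, i.e. moving
the pair by `γ` while rotating its form factor: relabelling `c_{x,↑} c_{x+e,↓}` gives
`c_{γx,↑} c_{γx+γe,↓}` and the steps `e ↦ γ e` are a permutation of `{0, ±e₁, ±e₂}`.
[cite: Scalapino1995, §2 eq. (2.2)–(2.3)] -/
theorem relabel_d4Perm_localPair (γ : DihedralGroup 4) (g : Site 2 → ℝ) (x : TorusSite 2 L) :
    relabel (Orb.d4Perm γ) (localPair (g ∘ d4Vec γ) L x) = localPair g L (d4Site γ x) := by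
  unfold localPair
  rw [relabel_sum]
  simp only [relabel_smul, relabel_sub, relabel_mul, relabel_d4Perm_annihilation, d4Site_add,
    ← Torus.proj_d4Vec, Function.comp_apply]
  exact sum_steps_d4Vec γ fun e => ((g e / Real.sqrt 2 : ℝ) : ℂ) •
    (annihilation (orb (FermionTorus.ofTorusSite (d4Site γ x)) 0) *
        annihilation (orb (FermionTorus.ofTorusSite (d4Site γ x + Torus.proj L e)) 1) -
      annihilation (orb (FermionTorus.ofTorusSite (d4Site γ x)) 1) *
        annihilation (orb (FermionTorus.ofTorusSite (d4Site γ x + Torus.proj L e)) 0))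

/-- **`D₄` covariance of the pair field**: `U_γ Δ_{g∘γ} U_γ⁻¹ = Δ_g` (reindex the sites by `γ`).
[cite: Scalapino1995, §2 eq. (2.2)–(2.3)] -/
theorem relabel_d4Perm_pairField (γ : DihedralGroup 4) (g : Site 2 → ℝ) :
    relabel (Orb.d4Perm γ) (pairField (g ∘ d4Vec γ) L) = pairField g L := by
  unfold pairField
  rw [relabel_sum]
  simp_rw [relabel_d4Perm_localPair]
  exact Fintype.sum_equiv (d4SitePerm γ) _ _ fun x => rfl

/-- **The on-site `s`-wave pair field is `D₄` invariant**: `U_γ Δ_s U_γ⁻¹ = Δ_s`. [cite: Scalapino1995, §2] -/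
theorem relabel_d4Perm_pairField_sWave (γ : DihedralGroup 4) :
    relabel (Orb.d4Perm γ) (pairField sWave L) = pairField sWave L := by
  conv_lhs => rw [show sWave = sWave ∘ d4Vec γ from funext fun e => (sWave_d4Vec γ e).symm]
  exact relabel_d4Perm_pairField γ sWave

/-- **The extended `s`-wave pair field is `D₄` invariant.** [cite: Scalapino1995, §2] -/
theorem relabel_d4Perm_pairField_extendedSWave (γ : DihedralGroup 4) :
    relabel (Orb.d4Perm γ) (pairField extendedSWave L) = pairField extendedSWave L := by
  conv_lhs => rw [show extendedSWave = extendedSWave ∘ d4Vec γ from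
    funext fun e => (extendedSWave_d4Vec γ e).symm]
  exact relabel_d4Perm_pairField γ extendedSWave

/-- **The `d_{x²-y²}` pair field transforms in the `B₁g` representation of `D₄`**:
`U_γ Δ_d U_γ⁻¹ = χ_{B₁g}(γ) Δ_d`. [cite: Scalapino1995, §2 eq. (2.3)] -/
theorem relabel_d4Perm_pairField_dWave (γ : DihedralGroup 4) :
    relabel (Orb.d4Perm γ) (pairField dWaveFormFactor L) = b1gChar γ • pairField dWaveFormFactor L := by
  -- `g_d ∘ γ = c • g_d` with the real sign `c`, `(c : ℂ) = χ_{B₁g}(γ)`, `c² = 1`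
  obtain ⟨c, hc, hcχ⟩ : ∃ c : ℝ, (dWaveFormFactor ∘ d4Vec γ = fun e => c * dWaveFormFactor e) ∧
      (c : ℂ) = b1gChar γ := by
    refine ⟨match γ with | r i => (-1 : ℝ) ^ i.val | sr i => (-1 : ℝ) ^ i.val,
      funext fun e => dWaveFormFactor_d4Vec γ e, ?_⟩
    cases γ <;> (push_cast; rfl)
  have h := relabel_d4Perm_pairField (L := L) γ dWaveFormFactor
  rw [hc, pairField_const_mul, relabel_smul, hcχ] at h
  -- `χ • relabel Δ_d = Δ_d`; multiply by `χ` and use `χ² = 1`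
  calc relabel (Orb.d4Perm γ) (pairField dWaveFormFactor L)
      = (b1gChar γ * b1gChar γ) • relabel (Orb.d4Perm γ) (pairField dWaveFormFactor L) := by
        rw [b1gChar_mul_self, one_smul]
    _ = b1gChar γ • pairField dWaveFormFactor L := by rw [mul_smul, h]

/-- **The pair-field order parameters of all three channels are `D₄` invariant operators**:
`U_γ (Δ_g† Δ_g) U_γ⁻¹ = Δ_g† Δ_g` for `g ∈ {s, s*, d_{x²-y²}}` (for `d`: `|χ_{B₁g}|² = 1`).
[cite: Scalapino1995, §2] -/
theorem relabel_d4Perm_pairField_conjTranspose_mul (γ : DihedralGroup 4) (g : Site 2 → ℝ)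
    (hg : g = sWave ∨ g = extendedSWave ∨ g = dWaveFormFactor) :
    relabel (Orb.d4Perm γ) ((pairField g L)ᴴ * pairField g L) = (pairField g L)ᴴ * pairField g L := by
  rw [relabel_mul, relabel_conjTranspose]
  rcases hg with rfl | rfl | rfl
  · rw [relabel_d4Perm_pairField_sWave]
  · rw [relabel_d4Perm_pairField_extendedSWave]
  · rw [relabel_d4Perm_pairField_dWave, conjTranspose_smul, Matrix.smul_mul, Matrix.mul_smul, smul_smul,
      star_b1gChar_mul_self, one_smul]

/-- **The pair-field order parameters are invariant under the `D₄` unitaries**: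
`⟨U_γ ψ, Δ_g† Δ_g U_γ ψ⟩ = ⟨ψ, Δ_g† Δ_g ψ⟩` for `g ∈ {s, s*, d_{x²-y²}}`. [cite: Scalapino1995, §2] -/
theorem expect_pairField_fockD4_mulVec (γ : DihedralGroup 4) (g : Site 2 → ℝ)
    (hg : g = sWave ∨ g = extendedSWave ∨ g = dWaveFormFactor) (ψ : Fock (Orb (FermionTorus 2 L))) :
    expect ((pairField g L)ᴴ * pairField g L) ((fockD4 (L := L) γ).val *ᵥ ψ) =
      expect ((pairField g L)ᴴ * pairField g L) ψ := by
  have h := expect_relabel_fockRelabel_mulVec (Orb.d4Perm γ) ((pairField g L)ᴴ * pairField g L) ψ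
  rwa [relabel_d4Perm_pairField_conjTranspose_mul γ g hg] at h

end PointGroupPair



end Literature.MathematicalPhysics.QuantumLattice

end
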